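import Summits.Ventures.HSemireg.MethodInstanceG6ThetaSecantCells
import Mathlib.NumberTheory.Pell
import HarnessLib

/-!
# Venture HSemireg — REACH of the g = 6 theta-secant method instance: which Weil FIELDS `ℚ(√-d)` the family `𝓕_m = i_*𝒪_D(m·C_p)` touches
# (census D-2 «REACH» cell; `step0/THETA-SECANT-p1.md` §1 «COVERAGE (Pell)»), as kernel arithmetic + one composition

HONEST FRAMING. Lean index of the computation cell `pub-hsemireg` (seat p8, «Sunday typer § g = 6»; companion of
`MethodInstanceG6ThetaSecant.lean` / `…Cells.lean`). ARITHMETIC (Pell witnesses, a mod-4 law) and ONE composition with the landed cell theorem;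
no variety, sheaf or `Ext` group is constructed; the theta-secant rows enter BY VALUE. Nothing here says HC, HC_CM or HC_AV is proved; the
sixfold components reached are SPLIT ones (method instances, never the verdict's deciding rows: «NO-in-families-tried», candidates 0).

THE CELL OF RECORD (census `target-g6/CENSUS.md` v3.75 row D-2, last cell; `step0/THETA-SECANT-p1.md` v2.6 §1): the theta-secant object at
parameter `m` has Weil structure `ψ₀ = J_{P_m}` with `ψ₀² = -(m² − 1)`, field `K_m = ℚ(√(1 − m²)) = ℚ(√-d_m)`, `d_m` = squarefree part of
`m² − 1`, and is UNTWISTED (2-maximal) iff `m` is EVEN (UNTWIST THM 2); «COVERAGE (Pell): `K = ℚ(√-d)`, `d ≡ 3 (4)` squarefree, is reached by some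
`𝓕_m` iff `m² − d·k² = 1` has a solution with `k` odd (then `m` is even) iff the fundamental solution of `x² − dy² = 1` has `y` odd: YES for
`d = 3 (m=2), 7 (8), 11 (10), 15 (4), 19 (170), 23 (24), 31 (1520), 35 (6), 43 (3482), 47 (48), 51 (50), 59 (530), 67, 71, 79 (80), 83 (82), 87 (28),
91, 103, 107, 115, 119 (120)`; NO for `d = 39, 55, 95, 111` …; NOT reached: `ℚ(i)`, `ℚ(√-2)`, any `d ≢ 3 (4)`». What the kernel holds here:

* §1 the POSITIVE half as explicit Pell witnesses `m² = d·k² + 1`, `m` even, `k` odd, for the 22 fields of p1's YES list up to `119`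
  (`pellWitness_table`, by `decide`), incl. the five rows of record `m = 2, 4, 6, 8, 10` (`d = 3, 15, 35, 7·3², 11·3²`).
* §2 the NEGATIVE half, arithmetic: `m` even ∧ `m² = d·k² + 1` ⟹ `d ≡ 3 (mod 4)` ∧ `k` odd (`mod_four_eq_three_of_even_of_pell`) — so
  no EVEN `m` reaches `ℚ(i)`, `ℚ(√-2)` or any `d ≡ 1, 2 (mod 4)` —, and `m² = k² + 1 ⟹ m = 1` (`eq_one_of_sq_eq_sq_add_one`): `ℚ(i)` (`d = 1`) is
  reached by NO `m ≥ 2` at all, even or odd («ℚ(i) NOT reachable at n = 3»); and §2b the «NO for `d = 39, 55, 95, 111`» half FROM THE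
  STRUCTURE OF THE PELL SOLUTION SET (Mathlib's `Pell.IsFundamental.eq_zpow_or_neg_zpow`: every solution is `± a₁ⁿ`): the fundamental
  solutions `(25,4), (89,12), (39,4), (295,28)` — certified fundamental by explicit non-square witnesses `r² < 1 + d·y² < (r+1)²` for every
  `0 < y < y₁` — have EVEN `y`, hence so does every solution (`pell_even_y_39/55/95/111`, `thetaSecant_noList`): no `m` with `m² − d·k² = 1`,
  `k` odd, exists for these four `d`.
* §3 the COMPOSITION with the landed cell theorem (`weilAlgebraicAll_two_of_reach_of_perfectComplexRankTransfer_of_hyperbolicSeedOn_three_sq_mul`,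
  seat p8 gen 0): under `weilFamilyReach_hyperbolic` ∧ `PerfectComplexRankTransfer C` BY NAME and — BY VALUE, UNIFORMLY IN EVEN `m` — «the
  theta-secant construction at parameter `m` is a hyperbolic rank-class seed at level 3 with `ψ₀² = -(m² − 1)`» (`hrow`), the Weil classes of
  EVERY `ℚ(√-d)`-Weil abelian FOURFOLD are algebraic for each of the 22 listed `d` (`weilAlgebraicAll_two_pellList_…`), and — using ONLY the
  five rows of record `m ∈ {2, 4, 6, 8, 10}` (class ×3, rank 48 ×4, object side by the E₂/Künneth bound) — for `d ∈ {3, 7, 11, 15, 35}`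
  (`weilAlgebraicAll_two_rowsOfRecord_…`). TIER of `hrow` beyond the rows of record: the construction is m-UNIFORM on paper (class side
  `r = 48` kernel-derived for every twisted theta box, `MethodInstanceG6ThetaSecant.lean` §1; object side = the E₂ bound of `i_*L` on the theta
  divisor, independent of `m`; class exactness `b = -1/(m² − 1) ≠ 0` and 2-maximality for even `m`, THETA-SECANT-p1 §1 THM 1/THM 2), with the
  rank certificate additionally RUN at `m = 24` (`ℚ(√-23)`) and `m = 170` (`ℚ(√-19)`) ×1; at the other listed `m` it is an EXTRAPOLATION of
  that mechanism, labelled so. In print all of §3 is [Markman2025SecantWeil] Cor. 1.6.1 (PREPRINT; every `d`), refereed for `d = 3`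
  ([Schoen1988HodgeWeil], [Schoen1998HodgeWeilAddendum]); nothing new is claimed — the point is WHICH fields the cell's own g = 6 object reaches.
0 `def`, 0 `sorry`, 0 new named fact.
-/

noncomputable section

open CategoryTheory AlgebraicGeometry
open Literature.AlgebraicGeometry.Motives Literature.AlgebraicGeometry.HodgeTheory
open Literature.AlgebraicGeometry.ModuliOfAbelianVarieties Literature.AlgebraicGeometry.Deligne1982
open Literature.AlgebraicGeometry.KTheory
open Literature.AlgebraicTopology.SingularHomology

namespace Summit.Ventures.HSemireg

/-! ## §1 Pell witnesses: the 22 fields of p1's YES list (`d ≤ 119`), `m` even, `k` odd, `m² = d·k² + 1` -/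

/-- **The theta-secant parameters reaching `ℚ(√-d)`** (THETA-SECANT-p1 §1 COVERAGE, YES list up to `d = 119`; p1 printed `m` for 16 of them,
the other six — `d = 67, 71, 91, 103, 107, 115` — are the fundamental solutions, supplied here): each triple `(d, m, k)` has `m` EVEN, `k` ODD and
`m² = d·k² + 1`, so `ψ₀² = -(m² − 1) = -(k²·d)` and `K_m = ℚ(√-d)`. Rows of record: `(3,2,1), (15,4,1), (35,6,1), (7,8,3), (11,10,3)` = D-2…D-6.
[bookkeeping] -/
theorem pellWitness_table :
    ∀ t ∈ ([(3, 2, 1), (7, 8, 3), (11, 10, 3), (15, 4, 1), (19, 170, 39), (23, 24, 5), (31, 1520, 273), (35, 6, 1), (43, 3482, 531),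
      (47, 48, 7), (51, 50, 7), (59, 530, 69), (67, 48842, 5967), (71, 3480, 413), (79, 80, 9), (83, 82, 9), (87, 28, 3), (91, 1574, 165),
      (103, 227528, 22419), (107, 962, 93), (115, 1126, 105), (119, 120, 11)] : List (ℕ × ℕ × ℕ)),
      t.2.1 % 2 = 0 ∧ t.2.2 % 2 = 1 ∧ t.2.1 ^ 2 = t.1 * t.2.2 ^ 2 + 1 := by
  decide

/-! ## §2 The arithmetic NO: even `m` only reaches `d ≡ 3 (mod 4)`; `ℚ(i)` is reached by no `m ≥ 2` -/

/-- **`m` even, `m² = d·k² + 1` ⟹ `d ≡ 3 (mod 4)` and `k` odd** — so the UNTWISTED (even-`m`) theta-secant rows never reach `ℚ(i)`, `ℚ(√-2)` or any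
`ℚ(√-d)` with `d ≡ 1, 2 (mod 4)` (THETA-SECANT-p1 §1: «NOT reached: ℚ(i), ℚ(√−2), any d ≢ 3 (4) (UNTWIST COR: twisted)»). [bookkeeping] -/
theorem mod_four_eq_three_of_even_of_pell {m d k : ℕ} (hm : Even m) (h : m ^ 2 = d * k ^ 2 + 1) : d % 4 = 3 ∧ k % 2 = 1 := by
  obtain ⟨a, rfl⟩ := hm
  have hz : ((a + a : ℕ) : ZMod 4) ^ 2 = (d : ZMod 4) * (k : ZMod 4) ^ 2 + 1 := by exact_mod_cast congrArg (Nat.cast : ℕ → ZMod 4) h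
  have hd : (d : ZMod 4) = ((d % 4 : ℕ) : ZMod 4) := by rw [← ZMod.natCast_mod d 4]
  have hk : (k : ZMod 4) = ((k % 4 : ℕ) : ZMod 4) := by rw [← ZMod.natCast_mod k 4]
  have ha : (a : ZMod 4) = ((a % 4 : ℕ) : ZMod 4) := by rw [← ZMod.natCast_mod a 4]
  push_cast at hz
  rw [hd, hk, ha] at hz
  have hd4 := Nat.mod_lt d (by norm_num : 0 < 4)
  have hk4 := Nat.mod_lt k (by norm_num : 0 < 4)
  have ha4 := Nat.mod_lt a (by norm_num : 0 < 4)
  have hk2 : k % 2 = k % 4 % 2 := by omega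
  rw [hk2]
  revert hz
  generalize d % 4 = d' at hd4 ⊢
  generalize k % 4 = k' at hk4 ⊢
  generalize a % 4 = a' at ha4 ⊢
  interval_cases d' <;> interval_cases k' <;> interval_cases a' <;> decide

/-- **`m² = k² + 1 ⟹ m = 1` (and `k = 0`)**: the field `ℚ(i)` (`d = 1`) is reached by NO theta-secant parameter `m ≥ 2`, even or odd
(census D-2: «ℚ(i) NOT reachable at n = 3»). [bookkeeping] -/
theorem eq_one_of_sq_eq_sq_add_one {m k : ℕ} (h : m ^ 2 = k ^ 2 + 1) : m = 1 ∧ k = 0 := by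
  have hlt : k < m := by nlinarith
  have hle : m ≤ k + 1 := by nlinarith
  have hm : m = k + 1 := by omega
  subst hm
  constructor <;> nlinarith

/-! ## §2b The Pell NO-list `d = 39, 55, 95, 111`: every solution has `y` even (structure of the solution set) -/

section PellNo

open Pell

/-- If a fundamental solution has even `y`, then every solution has even `y` (all solutions are `± a₁ ^ n`). [bookkeeping] -/
theorem pell_even_y_of_isFundamental {d : ℤ} {a₁ : Solution₁ d} (h : IsFundamental a₁) (hy : Even a₁.y)
    (a : Solution₁ d) : Even a.y := by
  have hpow : ∀ n : ℕ, Even (a₁ ^ n).y := by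
    intro n
    induction n with
    | zero => simp [Solution₁.y_one]
    | succ n ih =>
      rw [pow_succ, Solution₁.y_mul]
      exact (hy.mul_left _).add (ih.mul_right _)
  have hzpow : ∀ n : ℤ, Even (a₁ ^ n).y := by
    intro n
    cases n with
    | ofNat n => simpa using hpow n
    | negSucc n => rw [zpow_negSucc, Solution₁.y_inv]; exact (hpow _).neg
  obtain ⟨n, hn | hn⟩ := h.eq_zpow_or_neg_zpow a
  · rw [hn]; exact hzpow n
  · rw [hn, Solution₁.y_neg]; exact (hzpow n).neg

/-- `r² < N < (r+1)²` ⟹ `N` is not a square. [bookkeeping] -/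
theorem not_isSquare_of_sq_lt_lt {N : ℕ} (r : ℕ) (h1 : r ^ 2 < N) (h2 : N < (r + 1) ^ 2) : ¬ IsSquare N := by
  rintro ⟨t, rfl⟩
  rcases le_or_gt t r with h | h
  · exact absurd h1 (not_lt.2 (by nlinarith))
  · exact absurd h2 (not_lt.2 (by nlinarith))

/-- A positive solution `(x₁, y₁)` of `x² − d·y² = 1` (`d ≥ 1`) is FUNDAMENTAL as soon as no `0 < y < y₁` makes `1 + d·y²` a square
(then no solution has `1 < x < x₁`). [bookkeeping] -/
theorem pell_isFundamental_of_noSmaller {d : ℕ} (a₁ : Solution₁ (d : ℤ)) (hx : 1 < a₁.x) {y₁ : ℕ} (hy₁ : a₁.y = y₁) (hy : 0 < y₁)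
    (hno : ∀ y ∈ Finset.Ioo 0 y₁, ¬ IsSquare (1 + d * y ^ 2)) : IsFundamental a₁ := by
  refine ⟨hx, by rw [hy₁]; exact_mod_cast hy, fun {b} hb ↦ ?_⟩
  by_contra hlt
  push Not at hlt
  have hbprop := b.prop_x
  have ha₁prop := a₁.prop_x
  have hd : (0 : ℤ) < d := Solution₁.d_pos_of_one_lt_x hx
  have hby0 : b.y ≠ 0 := Solution₁.y_ne_zero_of_one_lt_x hb
  have hysq : b.y ^ 2 < a₁.y ^ 2 := by nlinarith
  have habs : |b.y| < a₁.y := abs_lt_of_sq_lt_sq hysq (by rw [hy₁]; exact_mod_cast hy.le)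
  have hmem : b.y.natAbs ∈ Finset.Ioo 0 y₁ := by
    rw [Finset.mem_Ioo]
    refine ⟨Int.natAbs_pos.2 hby0, ?_⟩
    have : (b.y.natAbs : ℤ) < y₁ := by rw [Int.natCast_natAbs, ← hy₁]; exact habs
    exact_mod_cast this
  refine hno _ hmem ⟨b.x.natAbs, ?_⟩
  have h1 : ((b.x.natAbs ^ 2 : ℕ) : ℤ) = ((1 + d * b.y.natAbs ^ 2 : ℕ) : ℤ) := by
    push_cast
    rw [sq_abs, sq_abs, hbprop]
  have h2 : b.x.natAbs ^ 2 = 1 + d * b.y.natAbs ^ 2 := by exact_mod_cast h1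
  rw [← h2, sq]


/-- No `0 < y < 4` makes `1 + 39·y²` a square (so `(25, 4)` is the fundamental solution for `d = 39`). [bookkeeping] -/
theorem pell_noSmaller_39 : ∀ y ∈ Finset.Ioo 0 4, ¬ IsSquare (1 + 39 * y ^ 2) := by
  intro y hy
  rw [Finset.mem_Ioo] at hy
  obtain ⟨h1, h2⟩ := hy
  interval_cases y
  · exact not_isSquare_of_sq_lt_lt 6 (by norm_num) (by norm_num) -- y = 1: 40
  · exact not_isSquare_of_sq_lt_lt 12 (by norm_num) (by norm_num) -- y = 2: 157
  · exact not_isSquare_of_sq_lt_lt 18 (by norm_num) (by norm_num) -- y = 3: 352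

/-- **`d = 39`: every solution of `x² − 39·y² = 1` has `y` EVEN** (fundamental solution `(25, 4)`), so no theta-secant parameter `m`
(which needs `m² − 39·k² = 1` with `k` odd) reaches `ℚ(√-39)` — THETA-SECANT-p1 §1 «NO for d = 39, 55, 95, 111». [bookkeeping] -/
theorem pell_even_y_39 (a : Solution₁ 39) : Even a.y :=
  pell_even_y_of_isFundamental
    (pell_isFundamental_of_noSmaller (d := 39) (Solution₁.mk 25 4 (by norm_num)) (by rw [Solution₁.x_mk]; norm_num)
      (y₁ := 4) (by rw [Solution₁.y_mk]; rfl) (by norm_num) pell_noSmaller_39)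
    (by rw [Solution₁.y_mk]; decide) a


/-- No `0 < y < 12` makes `1 + 55·y²` a square (so `(89, 12)` is the fundamental solution for `d = 55`). [bookkeeping] -/
theorem pell_noSmaller_55 : ∀ y ∈ Finset.Ioo 0 12, ¬ IsSquare (1 + 55 * y ^ 2) := by
  intro y hy
  rw [Finset.mem_Ioo] at hy
  obtain ⟨h1, h2⟩ := hy
  interval_cases y
  · exact not_isSquare_of_sq_lt_lt 7 (by norm_num) (by norm_num) -- y = 1: 56
  · exact not_isSquare_of_sq_lt_lt 14 (by norm_num) (by norm_num) -- y = 2: 221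
  · exact not_isSquare_of_sq_lt_lt 22 (by norm_num) (by norm_num) -- y = 3: 496
  · exact not_isSquare_of_sq_lt_lt 29 (by norm_num) (by norm_num) -- y = 4: 881
  · exact not_isSquare_of_sq_lt_lt 37 (by norm_num) (by norm_num) -- y = 5: 1376
  · exact not_isSquare_of_sq_lt_lt 44 (by norm_num) (by norm_num) -- y = 6: 1981
  · exact not_isSquare_of_sq_lt_lt 51 (by norm_num) (by norm_num) -- y = 7: 2696
  · exact not_isSquare_of_sq_lt_lt 59 (by norm_num) (by norm_num) -- y = 8: 3521
  · exact not_isSquare_of_sq_lt_lt 66 (by norm_num) (by norm_num) -- y = 9: 4456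
  · exact not_isSquare_of_sq_lt_lt 74 (by norm_num) (by norm_num) -- y = 10: 5501
  · exact not_isSquare_of_sq_lt_lt 81 (by norm_num) (by norm_num) -- y = 11: 6656

/-- **`d = 55`: every solution of `x² − 55·y² = 1` has `y` EVEN** (fundamental solution `(89, 12)`), so no theta-secant parameter `m`
(which needs `m² − 55·k² = 1` with `k` odd) reaches `ℚ(√-55)` — THETA-SECANT-p1 §1 «NO for d = 39, 55, 95, 111». [bookkeeping] -/
theorem pell_even_y_55 (a : Solution₁ 55) : Even a.y :=
  pell_even_y_of_isFundamental
    (pell_isFundamental_of_noSmaller (d := 55) (Solution₁.mk 89 12 (by norm_num)) (by rw [Solution₁.x_mk]; norm_num)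
      (y₁ := 12) (by rw [Solution₁.y_mk]; rfl) (by norm_num) pell_noSmaller_55)
    (by rw [Solution₁.y_mk]; decide) a


/-- No `0 < y < 4` makes `1 + 95·y²` a square (so `(39, 4)` is the fundamental solution for `d = 95`). [bookkeeping] -/
theorem pell_noSmaller_95 : ∀ y ∈ Finset.Ioo 0 4, ¬ IsSquare (1 + 95 * y ^ 2) := by
  intro y hy
  rw [Finset.mem_Ioo] at hy
  obtain ⟨h1, h2⟩ := hy
  interval_cases y
  · exact not_isSquare_of_sq_lt_lt 9 (by norm_num) (by norm_num) -- y = 1: 96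
  · exact not_isSquare_of_sq_lt_lt 19 (by norm_num) (by norm_num) -- y = 2: 381
  · exact not_isSquare_of_sq_lt_lt 29 (by norm_num) (by norm_num) -- y = 3: 856

/-- **`d = 95`: every solution of `x² − 95·y² = 1` has `y` EVEN** (fundamental solution `(39, 4)`), so no theta-secant parameter `m`
(which needs `m² − 95·k² = 1` with `k` odd) reaches `ℚ(√-95)` — THETA-SECANT-p1 §1 «NO for d = 39, 55, 95, 111». [bookkeeping] -/
theorem pell_even_y_95 (a : Solution₁ 95) : Even a.y :=
  pell_even_y_of_isFundamental
    (pell_isFundamental_of_noSmaller (d := 95) (Solution₁.mk 39 4 (by norm_num)) (by rw [Solution₁.x_mk]; norm_num)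
      (y₁ := 4) (by rw [Solution₁.y_mk]; rfl) (by norm_num) pell_noSmaller_95)
    (by rw [Solution₁.y_mk]; decide) a


/-- No `0 < y < 28` makes `1 + 111·y²` a square (so `(295, 28)` is the fundamental solution for `d = 111`). [bookkeeping] -/
theorem pell_noSmaller_111 : ∀ y ∈ Finset.Ioo 0 28, ¬ IsSquare (1 + 111 * y ^ 2) := by
  intro y hy
  rw [Finset.mem_Ioo] at hy
  obtain ⟨h1, h2⟩ := hy
  interval_cases y
  · exact not_isSquare_of_sq_lt_lt 10 (by norm_num) (by norm_num) -- y = 1: 112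
  · exact not_isSquare_of_sq_lt_lt 21 (by norm_num) (by norm_num) -- y = 2: 445
  · exact not_isSquare_of_sq_lt_lt 31 (by norm_num) (by norm_num) -- y = 3: 1000
  · exact not_isSquare_of_sq_lt_lt 42 (by norm_num) (by norm_num) -- y = 4: 1777
  · exact not_isSquare_of_sq_lt_lt 52 (by norm_num) (by norm_num) -- y = 5: 2776
  · exact not_isSquare_of_sq_lt_lt 63 (by norm_num) (by norm_num) -- y = 6: 3997
  · exact not_isSquare_of_sq_lt_lt 73 (by norm_num) (by norm_num) -- y = 7: 5440
  · exact not_isSquare_of_sq_lt_lt 84 (by norm_num) (by norm_num) -- y = 8: 7105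
  · exact not_isSquare_of_sq_lt_lt 94 (by norm_num) (by norm_num) -- y = 9: 8992
  · exact not_isSquare_of_sq_lt_lt 105 (by norm_num) (by norm_num) -- y = 10: 11101
  · exact not_isSquare_of_sq_lt_lt 115 (by norm_num) (by norm_num) -- y = 11: 13432
  · exact not_isSquare_of_sq_lt_lt 126 (by norm_num) (by norm_num) -- y = 12: 15985
  · exact not_isSquare_of_sq_lt_lt 136 (by norm_num) (by norm_num) -- y = 13: 18760
  · exact not_isSquare_of_sq_lt_lt 147 (by norm_num) (by norm_num) -- y = 14: 21757
  · exact not_isSquare_of_sq_lt_lt 158 (by norm_num) (by norm_num) -- y = 15: 24976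
  · exact not_isSquare_of_sq_lt_lt 168 (by norm_num) (by norm_num) -- y = 16: 28417
  · exact not_isSquare_of_sq_lt_lt 179 (by norm_num) (by norm_num) -- y = 17: 32080
  · exact not_isSquare_of_sq_lt_lt 189 (by norm_num) (by norm_num) -- y = 18: 35965
  · exact not_isSquare_of_sq_lt_lt 200 (by norm_num) (by norm_num) -- y = 19: 40072
  · exact not_isSquare_of_sq_lt_lt 210 (by norm_num) (by norm_num) -- y = 20: 44401
  · exact not_isSquare_of_sq_lt_lt 221 (by norm_num) (by norm_num) -- y = 21: 48952
  · exact not_isSquare_of_sq_lt_lt 231 (by norm_num) (by norm_num) -- y = 22: 53725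
  · exact not_isSquare_of_sq_lt_lt 242 (by norm_num) (by norm_num) -- y = 23: 58720
  · exact not_isSquare_of_sq_lt_lt 252 (by norm_num) (by norm_num) -- y = 24: 63937
  · exact not_isSquare_of_sq_lt_lt 263 (by norm_num) (by norm_num) -- y = 25: 69376
  · exact not_isSquare_of_sq_lt_lt 273 (by norm_num) (by norm_num) -- y = 26: 75037
  · exact not_isSquare_of_sq_lt_lt 284 (by norm_num) (by norm_num) -- y = 27: 80920

/-- **`d = 111`: every solution of `x² − 111·y² = 1` has `y` EVEN** (fundamental solution `(295, 28)`), so no theta-secant parameter `m`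
(which needs `m² − 111·k² = 1` with `k` odd) reaches `ℚ(√-111)` — THETA-SECANT-p1 §1 «NO for d = 39, 55, 95, 111». [bookkeeping] -/
theorem pell_even_y_111 (a : Solution₁ 111) : Even a.y :=
  pell_even_y_of_isFundamental
    (pell_isFundamental_of_noSmaller (d := 111) (Solution₁.mk 295 28 (by norm_num)) (by rw [Solution₁.x_mk]; norm_num)
      (y₁ := 28) (by rw [Solution₁.y_mk]; rfl) (by norm_num) pell_noSmaller_111)
    (by rw [Solution₁.y_mk]; decide) a


/-- The four NO-fields in the cell's ℕ-currency: `m² = d·k² + 1 ⟹ k` even, for `d ∈ {39, 55, 95, 111}`. [bookkeeping] -/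
theorem thetaSecant_noList (d : ℕ) (hd : d = 39 ∨ d = 55 ∨ d = 95 ∨ d = 111) {m k : ℕ} (h : m ^ 2 = d * k ^ 2 + 1) : Even k := by
  have key : ∀ (d' : ℤ), (∀ a : Solution₁ d', Even a.y) → (m : ℤ) ^ 2 - d' * (k : ℤ) ^ 2 = 1 → Even k := by
    intro d' hall hmk
    have := hall (Solution₁.mk (m : ℤ) (k : ℤ) hmk)
    rw [Solution₁.y_mk] at this
    exact (Int.even_coe_nat k).1 this
  have hz : ((m ^ 2 : ℕ) : ℤ) = ((d * k ^ 2 + 1 : ℕ) : ℤ) := by exact_mod_cast h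
  push_cast at hz
  rcases hd with rfl | rfl | rfl | rfl
  · exact key 39 pell_even_y_39 (by linarith)
  · exact key 55 pell_even_y_55 (by linarith)
  · exact key 95 pell_even_y_95 (by linarith)
  · exact key 111 pell_even_y_111 (by linarith)

end PellNo

/-! ## §3 Composition: which fourfold fields the theta-secant family reaches, given its rows by value -/

section Reach

open Summit.HodgeConjecture.HodgeConjecture
open Summit.HodgeConjecture.HodgeConjecture.WeilTypeLadder
open Summit.HodgeConjecture.HodgeConjecture.Cruxes.HodgeAbelianVarieties.EStepSecantInduction
open Summit.Ventures.HSemireg.GeneralStructure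

variable {C : ChernCharacterBetti}

/-- **ROWS OF RECORD ONLY (`m = 2, 4, 6, 8, 10`; census D-2…D-6, class ×3, rank 48 ×4): the theta-secant family gives ALL `ℚ(√-d)`-Weil abelian
FOURFOLDS for `d ∈ {3, 7, 11, 15, 35}`** — under `weilFamilyReach_hyperbolic` ∧ `PerfectComplexRankTransfer C` BY NAME and the five rows as
hyperbolic rank-class seeds at level 3 with `ψ₀² = -(m² − 1)` BY VALUE (`h2 h4 h6 h8 h10`; seat p8 gen 0's `hasHyperbolicSeedOn_rank_three_of_complex`
is how a row becomes such a seed). `63 = 3²·7`, `99 = 3²·11`: the square descends (`…_sq_mul`). In print: [Markman2025SecantWeil] Cor. 1.6.1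
(PREPRINT); `d = 3` refereed ([Schoen1988HodgeWeil] Thm. 3.2 + [Schoen1998HodgeWeilAddendum]). Nothing asserted about non-split SIXFOLDS.
[cite: Markman2025SecantWeil, Cor. 1.6.1 (preprint)] [cite: Schoen1998HodgeWeilAddendum, §10] [cite: Deligne1982HodgeCycles, proof of Thm. 4.8] -/
theorem weilAlgebraicAll_two_rowsOfRecord_of_reach_of_perfectComplexRankTransfer_of_thetaSecantSeeds
    (hF : weilFamilyReach_hyperbolic) (hT : PerfectComplexRankTransfer C)
    (h2 : HasHyperbolicSeedOn (rankObjClass C) 3 (2 ^ 2 - 1)) (h4 : HasHyperbolicSeedOn (rankObjClass C) 3 (4 ^ 2 - 1))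
    (h6 : HasHyperbolicSeedOn (rankObjClass C) 3 (6 ^ 2 - 1)) (h8 : HasHyperbolicSeedOn (rankObjClass C) 3 (8 ^ 2 - 1))
    (h10 : HasHyperbolicSeedOn (rankObjClass C) 3 (10 ^ 2 - 1)) :
    WeilAlgebraicAll 2 3 ∧ WeilAlgebraicAll 2 7 ∧ WeilAlgebraicAll 2 11 ∧ WeilAlgebraicAll 2 15 ∧ WeilAlgebraicAll 2 35 := by
  have e := fun (N d : ℕ) (hN : 0 < N) (hd : 0 < d) (hS : HasHyperbolicSeedOn (rankObjClass C) 3 (N ^ 2 * d)) ↦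
    (weilAlgebraicAll_two_of_reach_of_perfectComplexRankTransfer_of_hyperbolicSeedOn_three_sq_mul hF hT hN hd hS).1
  exact ⟨e 1 3 one_pos (by norm_num) (by simpa using h2), e 3 7 (by norm_num) (by norm_num) (by simpa using h8),
    e 3 11 (by norm_num) (by norm_num) (by simpa using h10), e 1 15 one_pos (by norm_num) (by simpa using h4),
    e 1 35 one_pos (by norm_num) (by simpa using h6)⟩

/-- **THE PELL LIST (extrapolating the m-uniform mechanism; see the module docstring for the tier): if the theta-secant construction is a
hyperbolic rank-class seed at level 3 with `ψ₀² = -(m² − 1)` for EVERY even `m ≥ 2` (`hrow`, BY VALUE, uniform), then ALL `ℚ(√-d)`-Weil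
abelian FOURFOLDS have algebraic Weil classes for each of the 22 fields `d ≤ 119` of p1's YES list** — the witnesses of `pellWitness_table`
turn `m² − 1` into `k²·d` and the square descends. Used instances of `hrow`: `m ∈ {2, 4, 6, 8, 10}` (rows of record), `24, 170` (rank run ×1),
and `28, 48, 50, 80, 82, 120, 530, 962, 1126, 1520, 1574, 3480, 3482, 48842, 227528` (NOT computed — extrapolation). In print: [Markman2025SecantWeil]
Cor. 1.6.1 for every `d` (PREPRINT). Nothing asserted about non-split sixfolds, `ℚ(i)`, `ℚ(√-2)`, or `d ≢ 3 (mod 4)` (§2: not reachable this way).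
[cite: Markman2025SecantWeil, Cor. 1.6.1 (preprint)] [cite: Schoen1998HodgeWeilAddendum, §10] [cite: Deligne1982HodgeCycles, proof of Thm. 4.8] -/
theorem weilAlgebraicAll_two_pellList_of_reach_of_perfectComplexRankTransfer_of_thetaSecantSeeds
    (hF : weilFamilyReach_hyperbolic) (hT : PerfectComplexRankTransfer C)
    (hrow : ∀ m : ℕ, Even m → 2 ≤ m → HasHyperbolicSeedOn (rankObjClass C) 3 (m ^ 2 - 1)) :
    ∀ d ∈ [3, 7, 11, 15, 19, 23, 31, 35, 43, 47, 51, 59, 67, 71, 79, 83, 87, 91, 103, 107, 115, 119], WeilAlgebraicAll 2 d := by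
  have e : ∀ d m k : ℕ, m % 2 = 0 → 2 ≤ m → 0 < k → 0 < d → m ^ 2 = d * k ^ 2 + 1 → WeilAlgebraicAll 2 d := by
    intro d m k hm h2m hk hd h
    have hS : HasHyperbolicSeedOn (rankObjClass C) 3 (k ^ 2 * d) := by
      have h' : m ^ 2 - 1 = k ^ 2 * d := by rw [h]; ring_nf; omega
      exact h' ▸ hrow m (Nat.even_iff.2 hm) h2m
    exact (weilAlgebraicAll_two_of_reach_of_perfectComplexRankTransfer_of_hyperbolicSeedOn_three_sq_mul hF hT hk hd hS).1
  intro d hd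
  simp only [List.mem_cons, List.mem_nil_iff, or_false] at hd
  rcases hd with rfl | rfl | rfl | rfl | rfl | rfl | rfl | rfl | rfl | rfl | rfl | rfl | rfl | rfl | rfl | rfl | rfl | rfl | rfl |
    rfl | rfl | rfl
  · exact e 3 2 1 (by norm_num) (by norm_num) (by norm_num) (by norm_num) (by norm_num)
  · exact e 7 8 3 (by norm_num) (by norm_num) (by norm_num) (by norm_num) (by norm_num)
  · exact e 11 10 3 (by norm_num) (by norm_num) (by norm_num) (by norm_num) (by norm_num)
  · exact e 15 4 1 (by norm_num) (by norm_num) (by norm_num) (by norm_num) (by norm_num)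
  · exact e 19 170 39 (by norm_num) (by norm_num) (by norm_num) (by norm_num) (by norm_num)
  · exact e 23 24 5 (by norm_num) (by norm_num) (by norm_num) (by norm_num) (by norm_num)
  · exact e 31 1520 273 (by norm_num) (by norm_num) (by norm_num) (by norm_num) (by norm_num)
  · exact e 35 6 1 (by norm_num) (by norm_num) (by norm_num) (by norm_num) (by norm_num)
  · exact e 43 3482 531 (by norm_num) (by norm_num) (by norm_num) (by norm_num) (by norm_num)
  · exact e 47 48 7 (by norm_num) (by norm_num) (by norm_num) (by norm_num) (by norm_num)
  · exact e 51 50 7 (by norm_num) (by norm_num) (by norm_num) (by norm_num) (by norm_num)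
  · exact e 59 530 69 (by norm_num) (by norm_num) (by norm_num) (by norm_num) (by norm_num)
  · exact e 67 48842 5967 (by norm_num) (by norm_num) (by norm_num) (by norm_num) (by norm_num)
  · exact e 71 3480 413 (by norm_num) (by norm_num) (by norm_num) (by norm_num) (by norm_num)
  · exact e 79 80 9 (by norm_num) (by norm_num) (by norm_num) (by norm_num) (by norm_num)
  · exact e 83 82 9 (by norm_num) (by norm_num) (by norm_num) (by norm_num) (by norm_num)
  · exact e 87 28 3 (by norm_num) (by norm_num) (by norm_num) (by norm_num) (by norm_num)
  · exact e 91 1574 165 (by norm_num) (by norm_num) (by norm_num) (by norm_num) (by norm_num)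
  · exact e 103 227528 22419 (by norm_num) (by norm_num) (by norm_num) (by norm_num) (by norm_num)
  · exact e 107 962 93 (by norm_num) (by norm_num) (by norm_num) (by norm_num) (by norm_num)
  · exact e 115 1126 105 (by norm_num) (by norm_num) (by norm_num) (by norm_num) (by norm_num)
  · exact e 119 120 11 (by norm_num) (by norm_num) (by norm_num) (by norm_num) (by norm_num)

end Reach

/-! ## Audit: nothing is decided here
KERNEL: §1 Pell witnesses (`decide`), §2 the mod-4 law and `m² = k² + 1 ⇒ m = 1`, §2b the NO-list `d ∈ {39, 55, 95, 111}` (Pell structure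
theorem + fundamental solutions certified by non-square witnesses), §3 two compositions with the landed cell theorem. BY NAME:
`weilFamilyReach_hyperbolic`, `PerfectComplexRankTransfer C`. BY VALUE: the theta-secant rows as level-3 hyperbolic rank-class seeds (five rows of
record in the first form; uniformly in even `m` in the second — an extrapolation beyond `m ≤ 10`, `24`, `170`). Not here: any non-split
sixfold, HC_CM, `σ ∘ ob = ⌟ch`; which `d ≡ 3 (mod 4)` beyond `119` are reached is not tabulated. -/

end Summit.Ventures.HSemireg

end
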